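import Summits.CriticalPhenomena.PercolationContinuityZ3.Theorems.PercNearOneGluingNoHeavyLowerTailFrontierDecRowsLeFive
import Literature.Probability.LatticeModels.SahiThirdOrderCorrelation
import HarnessLib

/-!
# The 4-point dec cubic frontier: the STAR row (orbit 42) and every ONE-SOURCE triple `E₃(D[s|X], D[s|Y], D[s|T]) ≥ 0` hold on EVERY finite
# weighted graph (all `n`) — by van den Berg–Häggström–Kahn conditional positive association, already in the tree

Support file (prover prim-l12-p1 gen 2, P1 line; `--supports stmt-CriticalPhenomena-4575`).  No definitions, no named facts, no sorries,
no `native_decide`.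

Bookkeeping correction to the four-point cubic frontier (prim-masterthm-p1 FRONTIER-4PT.md; `…FrontierDecRowsLeFive`, which certifies the
45 essential orbits for `n ≤ 5` and records "the all-`n` statements of the 37 unimplied orbits are OPEN").  One of the 37, the STAR
`(D[a|b], D[a|c], D[a|y])` (orbit `42`, `star_le_five`), is in fact a theorem on every finite weighted graph: it is the singleton case of the
tree's `Literature.Probability.Percolation.prodBernoulli_sahiE3_notReach_nonneg` —
`E₃({s ↮ X}, {s ↮ Y}, {s ↮ T}) ≥ 0` for ALL vertex sets `X, Y, T` — whose mechanism is: given `{s ↮ T}` the events `{s ↮ X}, {s ↮ Y}`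
(decreasing functions of the cluster `C_s`) are positively correlated (BHK 2006 Thm 1.3, tree theorem
`BHK2006_clusterConditionalPositiveAssociation_holds`), and Sahi's `E₃` dominates that conditional covariance after three Harris steps
(`prodBernoulli_sahiE3_nonneg_of_condHarris_lower`; Blinovsky 2013 / Sahi 2008 Thm 2 mechanism).  Equivalently (the identity behind it, for the
record): `E₃(f,g,h) = E[g·(f − Ef)·(h − Eh)] + Cov(fh, g)`.
The frontier's cone test used {F, group/hybrid 3PT-LB, GR3, sunflowers} + Harris as generators — not the BHK conditional rows — so "not implied"
there and "proved here" are consistent.  After this file: 36 of the 45 essential dec orbits remain open for general `n` (all census-clean).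

* `star_all` — `0 ≤ E₃({a↮b}, {a↮c}, {a↮y})` for every `n`, `w`, `a b c y` (no distinctness needed);
* `oneSource_sep_all` — `0 ≤ E₃(D[s|X], D[s|Y], D[s|T])` for every `n`, `w`, vertex `s` and terminal LISTS `X Y T` (the `E3GroupSepCert.sep`
  vocabulary of the E3GRP files; covers e.g. the five-terminal rows `E₃(D[o|S₁], D[o|S₂], D[o|S₃])` for relay sets `Sᵢ`);
* `frontier_42_all` — orbit `42` of `…FrontierDecRowsLeFive` in its own `row`/`connEvent` form, all `n`.
-/

namespace Summit.CriticalPhenomena.PercolationContinuityZ3.Theorems.FrontierDecRows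

open MeasureTheory CovTransferCert E3GroupSepCert HybridRows
open Literature.Probability.Percolation Literature.Probability.LatticeModels

variable {n : ℕ}

/-- `{ω | ∀ y ∈ Y, ω ∉ openConn s y}` is BHK's avoidance event `{s ↮ Y}` written with `Reachable`. [folklore] -/
theorem setOf_forall_not_openConn_eq (s : Fin n) (Y : List (Fin n)) :
    {ω : BondConfig (Fin n) | ∀ y ∈ Y, ω ∉ openConn s y} =
      {ω : BondConfig (Fin n) | ∀ y ∈ ({y | y ∈ Y} : Set (Fin n)), ¬ (openGraph ω).Reachable s y} := by
  ext ω
  simp only [Set.mem_setOf_eq, openConn]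

/-- **One-source group-separation triples, all `n`**: `0 ≤ E₃(D[s|X], D[s|Y], D[s|T])` for every finite weighted graph, every vertex `s`
and all terminal lists `X, Y, T` — the tree's `prodBernoulli_sahiE3_notReach_nonneg` (BHK 2006 Thm 1.3 + conditional-Harris mechanism) in the
`sep`/`connEvent` vocabulary. [this work] -/
theorem oneSource_sep_all (w : Sym2 (Fin n) → unitInterval) (s : Fin n) (X Y T : List (Fin n)) :
    0 ≤ sahiE3 (prodBernoulli w) (connEvent (sep [s] X)) (connEvent (sep [s] Y)) (connEvent (sep [s] T)) := by
  have h := prodBernoulli_sahiE3_notReach_nonneg w s {x | x ∈ X} {y | y ∈ Y} {t | t ∈ T}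
  simp only [connEvent_sep, List.mem_singleton, forall_eq]
  rw [setOf_forall_not_openConn_eq s X, setOf_forall_not_openConn_eq s Y, setOf_forall_not_openConn_eq s T]
  exact h

/-- **The STAR row on EVERY finite weighted graph** (orbit 42 of the four-point dec cubic frontier; `star_le_five` had `n ≤ 5`):
`0 ≤ E₃({a↮b}, {a↮c}, {a↮y})` for all `n`, `w`, `a b c y`. [this work] -/
theorem star_all (w : Sym2 (Fin n) → unitInterval) (a b c y : Fin n) :
    0 ≤ sahiE3 (prodBernoulli w) (openConn a b)ᶜ (openConn a c)ᶜ (openConn a y)ᶜ := by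
  have h := oneSource_sep_all w a [b] [c] [y]
  simp only [connEvent_sep, List.mem_singleton, forall_eq] at h
  simpa only [Set.compl_def] using h

/-- **Orbit 42 of `…FrontierDecRowsLeFive` for every `n`** (its `row`/`connEvent` form, no bound on `n`, no distinctness). [this work] -/
theorem frontier_42_all (w : Sym2 (Fin n) → unitInterval) (a b c y : Fin n) :
    0 ≤ sahiE3 (prodBernoulli w) (connEvent (row 42 n (a, b, c, y)).1) (connEvent (row 42 n (a, b, c, y)).2.1)
      (connEvent (row 42 n (a, b, c, y)).2.2) := by
  have hr : row 42 n (a, b, c, y) = (sep [a] [b], sep [a] [c], sep [a] [y]) := rfl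
  rw [hr]
  exact oneSource_sep_all w a [b] [c] [y]

/-- The same in the `cval`/`terms` (term-family) form of `frontier_le_five`, all `n`. [this work] -/
theorem frontier_42_cval_all (w : Sym2 (Fin n) → unitInterval) (a b c y : Fin n) :
    0 ≤ cval w (terms 42 n (a, b, c, y)) := by
  unfold terms
  rw [cval_e3Terms]
  exact frontier_42_all w a b c y

end Summit.CriticalPhenomena.PercolationContinuityZ3.Theorems.FrontierDecRows
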